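import Literature.AlgebraicGeometry.HodgeTheory.DworkSexticPencilHodgeLociOfGriffiths
import Literature.AlgebraicGeometry.HodgeTheory.GriffithsHolomorphicHodgeSubbundlesQP
import Literature.AlgebraicGeometry.HodgeTheory.SpecialisedHypersurfaceFamilyPoints
import Literature.AlgebraicGeometry.HodgeTheory.DworkSexticPencilChart
import HarnessLib

/-!
# The Dwork-pencil dichotomy from Griffiths' theorem in its QUASI-PROJECTIVE form (twin (β))

Family `hodge`, layer `Literature/AlgebraicGeometry/HodgeTheory`; theorems only (no definition, no named fact). Written by the prover
seat `hodge-nonav-20241-p1` (g19, cell `hodge-nonav`; route `Summits/HodgeConjecture/HodgeConjecture/Theses/DworkReflectionQuotients`,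
crux `GenericInvariantHodgeClasses` stmt-HodgeConjecture-24129) as the Dwork consumer twin (β) of the QP statement layer
`GriffithsHolomorphicHodgeSubbundlesQP` (p3 g35 decision (ii), 2026-08-29T03:34:35Z): the dichotomy
`DworkSextic.Voisin2002_dworkPencil_hodgeFiltrationTwo_locus_dichotomy`, derived in `DworkSexticPencilHodgeLociOfGriffiths` from the named
fact `Griffiths1968_holomorphicHodgeSubbundles`, is derived here from `Griffiths1968_holomorphicHodgeSubbundlesQP` — the statement the
cell's programme GRIFFITHS-HOLOMORPHY (prover-Bx g17) proves — so that, once `griffiths1968_holomorphicHodgeSubbundlesQP_holds` lands, the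
«Griffiths1968 general» input of route DworkReflectionQuotients' floor is a theorem.

* `isQuasiProjectiveOver_pencilTotal` — the total space `𝒳 = totalSpz ℂ 4 6 pencilSpz` is quasi-projective
  (`isQuasiProjectiveOver_totalSpz` with `pencilSpz_surjective` of `DworkSexticPencilChart`);
* `Voisin2002_dworkPencil_hodgeFiltrationTwo_locus_dichotomy_of_griffiths1968QP` — the dichotomy from the QP statement (the proof of the
  named-fact version verbatim, `h𝒳` threaded to the one application of `hG`).

Honest scope: CONDITIONAL on `Griffiths1968_holomorphicHodgeSubbundlesQP`; nothing here says HC, HC_CM or HC_AV is proved; rung F-H1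
not moved.

## References

* [VoisinHodgeI2002] C. Voisin, Hodge Theory and Complex Algebraic Geometry I (2002), §9.2.1, §10.2.1 Thm. 10.3.
* [VoisinHodgeII2003] C. Voisin, Hodge Theory and Complex Algebraic Geometry II (2003), §5.3.1 Lemma 5.13, §6.2.1.
* [Katz2009] N. M. Katz, Another look at the Dwork family, Progr. Math. 270 (2009), §3.
-/

noncomputable section

open _root_.Topology _root_.Filter
open scoped TensorProduct

namespace Literature.AlgebraicGeometry.HodgeTheory

section HodgeTheory

/-- Membership in the span of the basis vectors of degree `≥ r` is the vanishing of the coordinates of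
degree `< r`. [folklore] -/
private theorem mem_span_image_deg_iff {N : ℕ} {V : Type*} [AddCommGroup V] [Module ℂ V]
    (e : Module.Basis (Fin N) ℂ V) (deg : Fin N → ℤ) (r : ℤ) (y : V) :
    y ∈ Submodule.span ℂ (e '' {σ | r ≤ deg σ}) ↔ ∀ σ, deg σ < r → e.repr y σ = 0 := by
  rw [Module.Basis.mem_span_image]
  constructor
  · intro h σ hσ
    by_contra hne
    exact not_le.mpr hσ (h (Finsupp.mem_support_iff.mpr hne))
  · intro h σ hσ
    by_contra hlt
    exact Finsupp.mem_support_iff.mp hσ (h σ (not_le.mp hlt))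

end HodgeTheory

end Literature.AlgebraicGeometry.HodgeTheory

namespace Literature.AlgebraicGeometry.HodgeTheory.DworkSextic

open CategoryTheory MvPolynomial
open Literature.AlgebraicGeometry.Motives Literature.AlgebraicGeometry.Motives.UniversalHypersurface
open Literature.AlgebraicGeometry.HodgeTheory.UniversalHypersurface
open Literature.AlgebraicTopology.SingularHomology

/-! ### The total space of the Dwork pencil is quasi-projective -/

/-- **The total space of the Dwork pencil is quasi-projective** (a closed subscheme of the universal total space `𝒴_U`, which is
quasi-projective; `isQuasiProjectiveOver_totalSpz` with `pencilSpz` onto). [cite: VoisinHodgeII2003, §6.2.1] [cite: Katz2009, §3] -/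
theorem isQuasiProjectiveOver_pencilTotal : IsQuasiProjectiveOver (totalSpz ℂ 4 6 pencilSpz) :=
  isQuasiProjectiveOver_totalSpz 4 6 pencilSpz pencilSpz_surjective

/-- **Voisin I Thm. 10.3 (quasi-projective form `Griffiths1968_holomorphicHodgeSubbundlesQP`) ⟹ the dichotomy of the locus
`{s : ξ|_{𝒳_s} ∈ F²}` on the Dwork pencil** — TWIN (β) of `…_of_griffiths1968` with the extra binder `IsQuasiProjectiveOver 𝒳` supplied
by `isQuasiProjectiveOver_pencilTotal` (the total space of the pencil is a closed subscheme of the quasi-projective universal total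
space since `pencilSpz` is onto); otherwise verbatim:
(`Voisin2002_dworkPencil_hodgeFiltrationTwo_locus_dichotomy`, hitherto derived from the pencil-specific
named fact `Griffiths1968_dworkPencil_holomorphicHodgeFrames`), from the GENERAL named fact
`Griffiths1968_holomorphicHodgeSubbundles`: over a small path-connected open `W ∋ t` inside a chart
`ψ : D(ℂ) → ℂ¹` take the graded holomorphic frame `e(s)` of `H⁴(X_t; ℚ) ⊗ ℂ` adapted to the transported
Hodge flags (`exists_holomorphicFrame_of_subbundleFrames`); the tube class `ξ` restricted to `X_s` is the
transport of `ξ|_{X_t}` (`transportFun_fiberRestrict`), i.e. the FIXED vector `y₀ = Θ⁻¹(ξ|_{X_t})` read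
through the rational transport (`ofRatClassBaseChange_baseChange_eq_transportFun`), so `ξ|_{X_s} ∈ F²` iff
the coordinates of `y₀` of degree `< 2` in `e(s)` vanish — holomorphic functions of `ψ(s)`; accumulation
at `t` forces them to vanish near `ψ(t)` (identity theorem in one variable), hence the locus is a
neighbourhood of `t`. [cite: VoisinHodgeI2002, §10.2.1 Thm. 10.3 and §9.2.1]
[cite: VoisinHodgeII2003, §5.3.1 Lemma 5.13] -/
theorem Voisin2002_dworkPencil_hodgeFiltrationTwo_locus_dichotomy_of_griffiths1968QP
    (hG : Griffiths1968_holomorphicHodgeSubbundlesQP) :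
    Voisin2002_dworkPencil_hodgeFiltrationTwo_locus_dichotomy := by
  classical
  intro B hBo ξ t htB hfreq
  -- the family data
  have hf : IsSmoothProjectiveFamily pencil 4 := isSmoothProjectiveFamily_pencil
  have hS : IsQuasiProjectiveOver (baseSpz ℂ 4 6 pencilSpz) := isQuasiProjectiveOver_baseSpz 4 6 pencilSpz
  have h𝒳 : IsQuasiProjectiveOver (totalSpz ℂ 4 6 pencilSpz) := isQuasiProjectiveOver_pencilTotal
  haveI := smoothOfRelativeDimension_one_pencilBase
  have hU : IsCohomologicallyLocallyTrivialOn pencil (Set.univ : Set (ComplexPoints (baseSpz ℂ 4 6 pencilSpz))) :=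
    isCohomologicallyLocallyTrivialOn_univ_of_isSmoothProjectiveFamily pencil 1 hf hS
  let A : ∀ s : ComplexPoints (baseSpz ℂ 4 6 pencilSpz), HodgeModel 4 (fiberOver pencil s) := fun s ↦
    (exists_isReal_hodgeModel_holds 4 _ (hf.isSmoothProjective s)).choose
  have hA : ∀ s, (A s).IsHodgeSymmetric := fun s ↦
    (exists_isReal_hodgeModel_holds 4 _ (hf.isSmoothProjective s)).choose_spec.isHodgeSymmetric
  haveI : ∀ s : ComplexPoints (baseSpz ℂ 4 6 pencilSpz),
      Module.Finite ℚ (singularCohomology ℚ ℚ (ComplexPoints (fiberOver pencil s)) (2 * 2)) := fun s ↦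
    finite_singularCohomology_rat_complexPoints (hf.isSmoothProjective s) _
  haveI : HodgeTensorFacts.{0, 0} := Motives.hodgeTensorFacts_holds.{0, 0}
  -- topology of `D(ℂ)`: a manifold, hence locally path connected
  haveI : AlgebraicGeometry.LocallyOfFiniteType (baseSpz ℂ 4 6 pencilSpz).hom := hS.locallyOfFiniteType
  haveI : AlgebraicGeometry.IsSeparated (baseSpz ℂ 4 6 pencilSpz).hom := hS.isVarietyPair_ofScheme.isSeparated
  haveI : T2Space (ComplexPoints (baseSpz ℂ 4 6 pencilSpz)) :=
    Literature.NumberTheory.Transcendental.t2Space_algPoints_holds _ ℂ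
  letI := Motives.ComplexPoints.chartedSpace (baseSpz ℂ 4 6 pencilSpz) 1
  haveI : LocallyPathConnectedSpace (ComplexPoints (baseSpz ℂ 4 6 pencilSpz)) :=
    ChartedSpace.locallyPathConnectedSpace (EuclideanSpace ℝ (Fin (2 * 1))) _
  haveI : LocallyPathConnectedSpace (Set.univ : Set (ComplexPoints (baseSpz ℂ 4 6 pencilSpz))) :=
    isOpen_univ.locallyPathConnectedSpace
  have hrat : ∀ (x y : (Set.univ : Set (ComplexPoints (baseSpz ℂ 4 6 pencilSpz))))
      (γ : Path.Homotopic.Quotient x y) (α : complexBetti (fiberOver pencil x.1) (2 * 2)), IsRationalClass α →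
      IsRationalClass (transportFun pencil (2 * 2) hU γ α) :=
    fun x y γ α hα ↦ isRationalClass_transportFun_of_isSmoothProjectiveFamily pencil (2 * 2) 1 hf hS γ hα
  -- the point `t` as a point of the subtype `univ`, and the neighbourhood `B`
  set t₁ : (Set.univ : Set (ComplexPoints (baseSpz ℂ 4 6 pencilSpz))) := ⟨t, Set.mem_univ t⟩ with ht₁
  set N : Set (Set.univ : Set (ComplexPoints (baseSpz ℂ 4 6 pencilSpz))) := {u | u.1 ∈ B} with hNdef
  have hN : N ∈ 𝓝 t₁ := (hBo.preimage continuous_subtype_val).mem_nhds (by exact htB)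
  -- Griffiths' frames around `t`
  obtain ⟨W₀, hW₀o, ht₁W₀, hW₀N, hW₀pc, ψ, hW₀ψ, hfr⟩ := hG pencil 4 (2 * 2) 1 hf hS h𝒳 hU A hA t₁ t₁ N hN
  set T₁ : singularCohomology ℚ ℚ (ComplexPoints (fiberOver pencil t₁.1)) (2 * 2) ≃ₗ[ℚ]
      singularCohomology ℚ ℚ (ComplexPoints (fiberOver pencil t₁.1)) (2 * 2) := LinearEquiv.refl ℚ _ with hT₁def
  have hT₁ : ∃ δ₁ : Path.Homotopic.Quotient t₁ t₁,
      ∀ v, ofRatClass _ (2 * 2) (T₁ v) = transportFun pencil (2 * 2) hU δ₁ (ofRatClass _ (2 * 2) v) :=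
    ⟨Path.Homotopic.Quotient.refl t₁, fun v ↦ by rw [transportFun_refl]; rfl⟩
  choose r w hw hwhol using hfr T₁ hT₁
  obtain ⟨W, hWo, ht₁W, hWW₀, hWpc, hW⟩ := exists_holomorphicFrame_of_subbundleFrames pencil (2 * 2) hU t₁ hrat
    (fun u ↦ (A u.1).hodgeStructure (hf.isSmoothProjective u.1) (hA u.1) (2 * 2)) hW₀o hW₀pc ψ hW₀ψ
    ht₁W₀ hT₁ r w hw hwhol
  obtain ⟨N', deg, e, hflag, -, hcoord⟩ := hW t₁ ht₁W T₁ hT₁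
  have hWψ : W ⊆ ψ.source := hWW₀.trans hW₀ψ
  have hWB : ∀ u ∈ W, u.1 ∈ B := fun u hu ↦ hW₀N (hWW₀ hu)
  -- the fixed vector `y₀ = Θ⁻¹(ξ|_{X_t})`
  set y₀ : ℂ ⊗[ℚ] singularCohomology ℚ ℚ (ComplexPoints (fiberOver pencil t₁.1)) (2 * 2) :=
    (ofRatClassBaseChangeEquiv (hf.isSmoothProjective t) (2 * 2)).symm (fiberRestrict pencil htB (2 * 2) ξ)
    with hy₀
  -- KEY: over `W`, `ξ|_{X_u} ∈ F²` iff the coordinates of `y₀` of degree `< 2` in `e(u)` vanish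
  have hkey : ∀ (u : (Set.univ : Set (ComplexPoints (baseSpz ℂ 4 6 pencilSpz)))) (hu : u ∈ W),
      IsInHodgeFiltration 4 (fiberOver pencil u.1) (2 * 2) 2 (fiberRestrict pencil (hWB u hu) (2 * 2) ξ) ↔
        ∀ σ, deg σ < 2 → (e u).repr y₀ σ = 0 := by
    intro u hu
    -- a path from `t` to `u` inside `W` and a rational transport along it
    obtain ⟨ε, hεW⟩ : ∃ ε : Path t₁ u, ∀ r', ε r' ∈ W :=
      ⟨(hWpc.joinedIn t₁ ht₁W u hu).somePath, (hWpc.joinedIn t₁ ht₁W u hu).somePath_mem⟩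
    obtain ⟨T, hT⟩ := exists_ratTransport pencil (2 * 2) hU hrat (⟦ε⟧ : Path.Homotopic.Quotient t₁ u)
    have hT' : ∀ v, ofRatClass _ (2 * 2) (T v) =
        transportFun pencil (2 * 2) hU ⟦ε⟧ (ofRatClass _ (2 * 2) (T₁ v)) := fun v ↦ hT v
    have hF := hflag u hu ε hεW T hT' 2
    -- the transported vector is `ξ|_{X_u}`
    have hflat : ofRatClassBaseChangeEquiv (hf.isSmoothProjective u.1) (2 * 2) (T.toLinearMap.baseChange ℂ y₀) =
        fiberRestrict pencil (hWB u hu) (2 * 2) ξ := by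
      rw [ofRatClassBaseChangeEquiv_apply, ofRatClassBaseChange_baseChange_eq_transportFun pencil (2 * 2) hU
        ⟦ε⟧ T hT y₀, hy₀, ← ofRatClassBaseChangeEquiv_apply (hf.isSmoothProjective t) (2 * 2),
        LinearEquiv.apply_symm_apply]
      exact transportFun_fiberRestrict pencil (2 * 2) hU hBo ε (fun r' ↦ hWB _ (hεW r')) htB (hWB u hu) ξ
    rw [isInHodgeFiltration_iff_symm_mem_hodgeStructure_F (hf.isSmoothProjective u.1) (A u.1) (hA u.1),
      ← mem_span_image_deg_iff (e u) deg 2 y₀, ← hF, Motives.HodgeStructure.comapEquiv_F, Submodule.mem_comap,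
      ← hflat, LinearEquiv.symm_apply_apply]
    norm_cast
  -- the chart read as a map to `ℂ` (charts of the curve `D(ℂ)` are valued in `ℂ¹ = Fin 1 → ℂ`)
  let Lz : ℂ →L[ℂ] (Fin 1 → ℂ) := ContinuousLinearMap.pi fun _ ↦ ContinuousLinearMap.id ℂ ℂ
  have hLz : ∀ q : Fin 1 → ℂ, Lz (q 0) = q := fun q ↦ funext fun i ↦ by
    rw [Fin.fin_one_eq_zero i]; rfl
  let Φ : ComplexPoints (baseSpz ℂ 4 6 pencilSpz) → ℂ := fun p ↦ ψ ⟨p, Set.mem_univ p⟩ 0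
  have hΦψ : ∀ u : (Set.univ : Set (ComplexPoints (baseSpz ℂ 4 6 pencilSpz))), Lz (Φ u.1) = ψ u :=
    fun u ↦ hLz (ψ u)
  -- the coordinate functions of `y₀`, as holomorphic functions on `Ω = Lz⁻¹(ψ(W)) ⊆ ℂ`
  let g : Fin N' → ℂ → ℂ := fun σ z ↦ (e (ψ.symm (Lz z))).repr y₀ σ
  have hΩo : IsOpen (Lz ⁻¹' (ψ '' W)) := (ψ.isOpen_image_of_subset_source hWo hWψ).preimage Lz.continuous
  have hg : ∀ σ, AnalyticOnNhd ℂ (g σ) (Lz ⁻¹' (ψ '' W)) := fun σ ↦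
    (hcoord σ y₀).comp (Lz.analyticOnNhd _) (Set.mapsTo_preimage Lz (ψ '' W))
  have hgΦ : ∀ u ∈ W, ∀ σ, g σ (Φ u.1) = (e u).repr y₀ σ := by
    intro u hu σ
    show (e (ψ.symm (Lz (Φ u.1)))).repr y₀ σ = (e u).repr y₀ σ
    rw [hΦψ u, ψ.left_inv (hWψ hu)]
  have hz₀ : Φ t ∈ Lz ⁻¹' (ψ '' W) := by
    show Lz (Φ t₁.1) ∈ ψ '' W
    rw [hΦψ t₁]
    exact ⟨t₁, ht₁W, rfl⟩
  obtain ⟨ρ, hρ, hball⟩ := Metric.isOpen_iff.mp hΩo (Φ t) hz₀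
  -- `W` read in `D(ℂ)`, the continuity and local injectivity of `Φ` at `t`
  set V : Set (ComplexPoints (baseSpz ℂ 4 6 pencilSpz)) :=
    {p | (⟨p, Set.mem_univ p⟩ : (Set.univ : Set (ComplexPoints (baseSpz ℂ 4 6 pencilSpz)))) ∈ W} with hVdef
  have hmk : Continuous fun p : ComplexPoints (baseSpz ℂ 4 6 pencilSpz) ↦
      (⟨p, Set.mem_univ p⟩ : (Set.univ : Set (ComplexPoints (baseSpz ℂ 4 6 pencilSpz)))) :=
    continuous_id.subtype_mk _
  have hVo : IsOpen V := hWo.preimage hmk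
  have htV : t ∈ V := ht₁W
  have hΦc : ContinuousAt Φ t := by
    have h1 : ContinuousAt (fun p : ComplexPoints (baseSpz ℂ 4 6 pencilSpz) ↦ ψ ⟨p, Set.mem_univ p⟩) t :=
      ContinuousAt.comp (f := fun p : ComplexPoints (baseSpz ℂ 4 6 pencilSpz) ↦
        (⟨p, Set.mem_univ p⟩ : (Set.univ : Set (ComplexPoints (baseSpz ℂ 4 6 pencilSpz))))) (g := ψ)
        (ψ.continuousAt (hWψ ht₁W)) hmk.continuousAt
    exact ContinuousAt.comp (f := fun p : ComplexPoints (baseSpz ℂ 4 6 pencilSpz) ↦ ψ ⟨p, Set.mem_univ p⟩)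
      (g := fun q : Fin 1 → ℂ ↦ q 0) (continuous_apply (0 : Fin 1)).continuousAt h1
  have hinj : ∀ p ∈ V, Φ p = Φ t → p = t := by
    intro p hpV h
    have h' : ψ ⟨p, Set.mem_univ p⟩ = ψ t₁ := by rw [← hΦψ ⟨p, Set.mem_univ p⟩, ← hΦψ t₁]; exact congrArg Lz h
    exact congrArg Subtype.val (ψ.injOn (hWψ hpV) (hWψ ht₁W) h')
  have hΦt : Tendsto Φ (𝓝[≠] t) (𝓝[≠] (Φ t)) := by
    refine tendsto_nhdsWithin_of_tendsto_nhds_of_eventually_within Φ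
      (hΦc.tendsto.mono_left nhdsWithin_le_nhds) ?_
    filter_upwards [self_mem_nhdsWithin, mem_nhdsWithin_of_mem_nhds (hVo.mem_nhds htV)] with p hp hpV
    exact fun h ↦ hp (hinj p hpV h)
  -- accumulation of the locus at `t` ⟹ the coordinates of degree `< 2` vanish frequently near `Φ t`
  have hfreq' : ∃ᶠ p in 𝓝[≠] t, ∀ σ, deg σ < 2 → g σ (Φ p) = 0 := by
    refine (hfreq.and_eventually (mem_nhdsWithin_of_mem_nhds (hVo.mem_nhds htV))).mono ?_
    rintro p ⟨⟨hpB, hpF⟩, hpV⟩ σ hσ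
    rw [hgΦ ⟨p, Set.mem_univ p⟩ hpV σ]
    exact (hkey ⟨p, Set.mem_univ p⟩ hpV).mp hpF σ hσ
  have hfreqC : ∃ᶠ z in 𝓝[≠] (Φ t), ∀ σ, deg σ < 2 → g σ z = 0 := hΦt.frequently hfreq'
  -- identity theorem on the disc: they vanish identically near `Φ t`
  have hvanish : ∀ σ, deg σ < 2 → Set.EqOn (g σ) 0 (Metric.ball (Φ t) ρ) := fun σ hσ ↦
    AnalyticOnNhd.eqOn_zero_of_preconnected_of_frequently_eq_zero ((hg σ).mono hball)
      (convex_ball (Φ t) ρ).isPreconnected (Metric.mem_ball_self hρ) (hfreqC.mono fun z hz ↦ hz σ hσ)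
  -- hence `ξ|_{X_p} ∈ F²` for every `p ∈ V` with `Φ p` in the disc: a neighbourhood of `t`
  have hnhds : {p | p ∈ V ∧ Φ p ∈ Metric.ball (Φ t) ρ} ∈ 𝓝 t :=
    Filter.inter_mem (hVo.mem_nhds htV)
      (hΦc.preimage_mem_nhds (Metric.isOpen_ball.mem_nhds (Metric.mem_ball_self hρ)))
  refine Filter.mem_of_superset hnhds ?_
  rintro p ⟨hpV, hpball⟩
  refine ⟨hWB _ hpV, (hkey ⟨p, Set.mem_univ p⟩ hpV).mpr fun σ hσ ↦ ?_⟩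
  rw [← hgΦ ⟨p, Set.mem_univ p⟩ hpV σ]
  exact hvanish σ hσ hpball

end Literature.AlgebraicGeometry.HodgeTheory.DworkSextic

end
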